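import Literature.MathematicalPhysics.QuantumFieldTheory.Balaban1983to89.B2Eq224FirstStepFields
import Literature.MathematicalPhysics.QuantumFieldTheory.Balaban1983to89.B2Sect2BDensities

/-!
# `Balaban1983to89.B2Eq242Locality` — [Balaban1982Higgs2] (2.42) p. 566 for the explicit replaced terms of (2.36)–(2.40):
after the replacements of p. 565 and the removal (2.41) of the basic quadratic forms on `Λ′₆`, the remaining terms depend on
the new fields only through `Λ′₇ᶜB`, `Λ′₇ᶜψ` — PROVED term by term and stated in the typed form
`B2Sect2BDensities.Local250` of (2.42)/(2.50) (r14)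

statement-level skeleton of published theorems with citation tags; proofs where landed; nothing here is a claim about the Yang–Mills mass gap

PDF held: `paper:balaban1982-cmp86-higgs23-ii` (T. Bałaban, *(Higgs)₂,₃ quantum fields in a finite volume. II. An upper
bound*, Commun. Math. Phys. **86** (1982) 555–594, doi 10.1007/bf01214890; journal page = PDF page + 554); pp. 565–566
[PDF 11–12] READ AS IMAGES (`run/shared/lean/pub/pub-balaban/b2b-balaban-ref1/pages/1982-cmp86-higgs23-II/…-p011/p012-x2.png`).

CITATION HEADER — WHAT IS REPRODUCED.  SKELETON row **B2.Eq2.42** ((2.20)–(2.42)), member **(2.42)** p. 566, for the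
explicit right sides of (2.36), (2.37), (2.39), (2.40) built in this seat's `…B2Eq236Replacements` / `…B2Eq237FormSplit` /
`…B2Eq238ScalarBoundary` / `…B2Eq240ScalarForm` (p249639, p250005, p250054, p250447).  Unit `lit-balaban-p15` gen 3 (Phase-2
proof seat p15); B2 fold owner r02, second reader r14 (whose `B2Sect2BDensities.Local250` / `local242_iff` TYPE (2.42) as a
predicate; here that predicate is PROVED for the concrete terms); referee ref-4.  Inputs by name: r02's
`B2Eq224FirstStepFields.bdry226`, `B2Eq218Translation.restrict`; r14's `B2Sect2BDensities.Local250`.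

WHAT IS PRINTED (p. 566 [PDF 12], verbatim).  *"Let us denote by ρ^{(1),L}(Λ₀, B, θ₁B^{(1)}, ψ) a density given by the second
representation in (2.34), with the expressions on the left sides of (2.36)–(2.40) replaced by the expressions on the right
sides, obviously without the errors. Also let us denote by ρ′^{(1),L}(Λ₀, B, θ₁B^{(1)}, ψ) a density obtained from
ρ^{(1),L}(Λ₀, B, θ₁B^{(1)}, ψ) by removing the basic quadratic forms on Λ′₆ from (2.37), (2.40). Then we have
ρ^{(1),L}(Λ₀, B, θ₁B^{(1)}, ψ) = ρ′^{(1),L}(Λ₀, B, θ₁B^{(1)}, ψ)·exp[−½⟨Λ′₆B, Δ^{(1),L}Λ′₆B⟩ − ½⟨Λ′₆ψ, Δ^{(1),L}(Λ₂, B^{(1)})Λ′₆ψ⟩],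
(2.41)   ρ′^{(1),L}(Λ₀, B, θ₁B^{(1)}, ψ) = ρ′^{(1),L}(Λ₀, Λ′₇ᶜB, θ₁B^{(1)}, Λ′₇ᶜψ), (2.42) and ρ′^{(1),L} depends on Λ₇B^{(1)} only
through the factor Z^{(0)}_{Λ₅}(B^{(1)})."*

THE ARGUMENT (the print gives none; it is a support computation).  With `Λ′₇ ⊆ Λ′₆ ⊆ Λ′₅`: `Λ′₆ᶜ(Λ′₇ᶜB) = Λ′₆ᶜB`,
`(Λ′₅∩Λ′₆ᶜ)(Λ′₇ᶜB) = (Λ′₅∩Λ′₆ᶜ)B`, `(Λ′₆∩Λ′₇ᶜ)(Λ′₇ᶜB) = (Λ′₆∩Λ′₇ᶜ)B`, so the first two terms of (2.37) and of (2.40), and the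
right side of (2.36), are functions of `Λ′₇ᶜB` (resp. `Λ′₇ᶜψ`); the right side of (2.38) contains no new field; the right
side of (2.39) contains the FULL `ψ`, but `C^{(0)}_{Λ₅}(Λ₆ᶜ, B^{(1)})` does not couple `Λ₆` to the inner boundary of `Λ₅`
(*"imposing proper boundary conditions"*), and `Q*ψ` on `Λ₅∖Λ₆` only involves `Λ′₆ᶜψ` — so it too is a function of `Λ′₆ᶜψ`.

DICTIONARY: as in the sibling files; in addition `Λ6f : Finset X` ↤ the fine points of `Λ₆` (blocks `Λ′₆`: `hQ6`), the
DECOUPLING of `C6 = C^{(0)}_{Λ₅}(Λ₆ᶜ, B^{(1)})` as `hC6dec` (no matrix element from a `Λ₆` column to a `Λ₆ᶜ` row) and the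
geometry `hbdry6` (the inner endpoints of `st(Λ₅)` lie outside `Λ₆`, (2.8)); r14's `Local250 S S′ ρ′` (ρ′ unchanged under
`B ↦ 1_S·B`, `ψ ↦ 1_{S′}·ψ`) at `S = S′ = (Λ′₇)ᶜ`, with `Set.indicator (↑Λ′₇)ᶜ B = B − restrict Λ₇' B` (`indicator_compl_eq`).

WHAT IS KERNEL-CHECKED (zero `sorry`, standard axioms, no definitions).
 §1 `indicator_coe_eq_restrict`, `indicator_compl_eq`, `out_sub_restrict_out`, `restrict_sdiff_out`, `restrict_sdiff_out'`
    (the three mask identities);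
 §2 **`bdry226_out6`** (the right side of (2.39) sees only `Λ′₆ᶜψ`, from the decoupling), `bdry226_out7`;
 §3 in r14's typed form: `local250_of_invariant`, `form_terms_out7` / `form_terms_out7'` (the two main terms of
    (2.37) / (2.40) are unchanged under `B ↦ Λ′₇ᶜB`), **`local242_form_terms`** / **`local242_form_terms'`**,
    **`local242_bdry_vector`** ((2.36) right side), **`local242_bdry_scalar`** ((2.39) right side) — each `Local250 (↑Λ₇')ᶜ …`.
HONEST SCOPE.  Only the field dependence is treated (the clause on `Λ₇B^{(1)}` through `Z^{(0)}_{Λ₅}(B^{(1)})` concerns the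
background field inside the kernels and is not modelled); the decoupling of `C^{(0)}_{Λ₅}(Λ₆ᶜ, B^{(1)})` is a HYPOTHESIS in
the printed form.
-/

namespace Literature.MathematicalPhysics.QuantumFieldTheory.Balaban1983to89.B2Eq242Locality

open Matrix
open B2Eq218Translation (restrict)
open B2Eq224FirstStepFields (bdry226)
open B2Sect2BDensities (Local250)

variable {X Y : Type*} [DecidableEq Y]

/-! ## §1 Masks: `Λ′₇ᶜ` inside `Λ′₆ᶜ`, `Λ′₅∩Λ′₆ᶜ`, `Λ′₆∩Λ′₇ᶜ` -/

/-- r14's `Set.indicator` of a block region is r02's `restrict`. [cite: Balaban1982Higgs2, (2.42) p.566] -/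
theorem indicator_coe_eq_restrict (Λ₇' : Finset Y) (B : Y → ℝ) :
    Set.indicator (↑Λ₇' : Set Y) B = restrict Λ₇' B := by
  funext y
  simp only [Set.indicator_apply, Finset.mem_coe, restrict]

/-- `1_{Λ′₇ᶜ}·B = B − Λ′₇B`. [cite: Balaban1982Higgs2, (2.42) p.566] -/
theorem indicator_compl_eq (Λ₇' : Finset Y) (B : Y → ℝ) :
    Set.indicator (↑Λ₇' : Set Y)ᶜ B = B - restrict Λ₇' B := by
  rw [Set.indicator_compl, indicator_coe_eq_restrict]

/-- `Λ′₆ᶜ(Λ′₇ᶜB) = Λ′₆ᶜB` for `Λ′₇ ⊆ Λ′₆`. [cite: Balaban1982Higgs2, (2.42) p.566] -/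
theorem out_sub_restrict_out {Λ₆' Λ₇' : Finset Y} (h7 : Λ₇' ⊆ Λ₆') (B : Y → ℝ) :
    (B - restrict Λ₇' B) - restrict Λ₆' (B - restrict Λ₇' B) = B - restrict Λ₆' B := by
  funext y
  simp only [Pi.sub_apply, restrict]
  by_cases h6 : y ∈ Λ₆'
  · by_cases hy7 : y ∈ Λ₇' <;> simp [h6, hy7]
  · have hy7 : y ∉ Λ₇' := fun h => h6 (h7 h)
    simp [h6, hy7]

/-- `(S∖Λ′₆)(Λ′₇ᶜB) = (S∖Λ′₆)B` for `Λ′₇ ⊆ Λ′₆` (used with `S = Λ′₅`). [cite: Balaban1982Higgs2, (2.42) p.566] -/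
theorem restrict_sdiff_out {S Λ₆' Λ₇' : Finset Y} (h7 : Λ₇' ⊆ Λ₆') (B : Y → ℝ) :
    restrict (S \ Λ₆') (B - restrict Λ₇' B) = restrict (S \ Λ₆') B := by
  funext y
  simp only [restrict, Pi.sub_apply, Finset.mem_sdiff]
  by_cases h : y ∈ S ∧ y ∉ Λ₆'
  · have hy7 : y ∉ Λ₇' := fun hy => h.2 (h7 hy)
    simp [h, hy7]
  · simp [h]

/-- `(Λ′₆∖Λ′₇)(Λ′₇ᶜB) = (Λ′₆∖Λ′₇)B`. [cite: Balaban1982Higgs2, (2.42) p.566] -/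
theorem restrict_sdiff_out' (Λ₆' Λ₇' : Finset Y) (B : Y → ℝ) :
    restrict (Λ₆' \ Λ₇') (B - restrict Λ₇' B) = restrict (Λ₆' \ Λ₇') B := by
  funext y
  simp only [restrict, Pi.sub_apply, Finset.mem_sdiff]
  by_cases h : y ∈ Λ₆' ∧ y ∉ Λ₇'
  · simp [h]
  · simp [h]

/-! ## §2 The right side of (2.39) sees only `Λ′₆ᶜψ` -/

section Scalar

variable [Fintype X] [Fintype Y] [DecidableEq X]

/-- **Decoupling**: with `C6 = C^{(0)}_{Λ₅}(Λ₆ᶜ, B^{(1)})` having no matrix element from a `Λ₆` column to a `Λ₆ᶜ` row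
(`hC6dec`), the inner endpoints of `st(Λ₅)` outside `Λ₆` (`hbdry6`) and the block structure of `Λ₆` (`hQ6`), the boundary
term `aL⁻²Σ_{st(Λ₅)}φ(b₊)U(C6 Q*ψ)(b₋)` depends on `ψ` only through `Λ′₆ᶜψ`. [cite: Balaban1982Higgs2, (2.42) p.566] -/
theorem bdry226_out6 {c : ℝ} {Λ Λ6f : Finset X} {Λ₆' : Finset Y} {D C6 : Matrix X X ℝ} {Qs : Matrix X Y ℝ}
    (hQ6 : ∀ x'' y, Qs x'' y ≠ 0 → (x'' ∈ Λ6f ↔ y ∈ Λ₆'))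
    (hC6dec : ∀ x' x'', C6 x' x'' ≠ 0 → x'' ∈ Λ6f → x' ∈ Λ6f)
    (hbdry6 : ∀ x ∉ Λ, ∀ x' ∈ Λ, D x x' ≠ 0 → x' ∉ Λ6f) (φ : X → ℝ) (ψ : Y → ℝ) :
    bdry226 c Λ D C6 Qs φ ψ = bdry226 c Λ D C6 Qs φ (ψ - restrict Λ₆' ψ) := by
  unfold bdry226
  congr 1
  refine Finset.sum_congr rfl fun x hx => Finset.sum_congr rfl fun x' hx' => ?_
  by_cases hD : D x x' = 0
  · rw [hD, neg_zero, mul_zero, zero_mul, zero_mul]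
  · have hx'6 : x' ∉ Λ6f := hbdry6 x (Finset.mem_compl.1 hx) x' hx' hD
    congr 1
    change ∑ x'', C6 x' x'' * (Qs *ᵥ ψ) x'' = ∑ x'', C6 x' x'' * (Qs *ᵥ (ψ - restrict Λ₆' ψ)) x''
    refine Finset.sum_congr rfl fun x'' _ => ?_
    by_cases hC : C6 x' x'' = 0
    · rw [hC, zero_mul, zero_mul]
    · have hx''6 : x'' ∉ Λ6f := fun h => hx'6 (hC6dec x' x'' hC h)
      congr 1
      change ∑ y, Qs x'' y * ψ y = ∑ y, Qs x'' y * (ψ - restrict Λ₆' ψ) y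
      refine Finset.sum_congr rfl fun y _ => ?_
      by_cases hq : Qs x'' y = 0
      · rw [hq, zero_mul, zero_mul]
      · have hy6 : y ∉ Λ₆' := fun hy => hx''6 ((hQ6 x'' y hq).2 hy)
        rw [Pi.sub_apply, show restrict Λ₆' ψ y = 0 from if_neg hy6, sub_zero]

/-- Hence it depends on `ψ` only through `Λ′₇ᶜψ` (`Λ′₇ ⊆ Λ′₆`) — the (2.42) property of the right side of (2.39).
[cite: Balaban1982Higgs2, (2.42) p.566] -/
theorem bdry226_out7 {c : ℝ} {Λ Λ6f : Finset X} {Λ₆' Λ₇' : Finset Y} {D C6 : Matrix X X ℝ} {Qs : Matrix X Y ℝ}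
    (h7 : Λ₇' ⊆ Λ₆') (hQ6 : ∀ x'' y, Qs x'' y ≠ 0 → (x'' ∈ Λ6f ↔ y ∈ Λ₆'))
    (hC6dec : ∀ x' x'', C6 x' x'' ≠ 0 → x'' ∈ Λ6f → x' ∈ Λ6f)
    (hbdry6 : ∀ x ∉ Λ, ∀ x' ∈ Λ, D x x' ≠ 0 → x' ∉ Λ6f) (φ : X → ℝ) (ψ : Y → ℝ) :
    bdry226 c Λ D C6 Qs φ (ψ - restrict Λ₇' ψ) = bdry226 c Λ D C6 Qs φ ψ := by
  rw [bdry226_out6 hQ6 hC6dec hbdry6 φ (ψ - restrict Λ₇' ψ), out_sub_restrict_out h7,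
    ← bdry226_out6 hQ6 hC6dec hbdry6 φ ψ]

end Scalar

/-! ## §3 (2.42) in the typed form `Local250 (Λ′₇)ᶜ (Λ′₇)ᶜ` -/

section Typed

/-- A density built from a `B`-functional invariant under `B ↦ 1_S·B` and a `ψ`-functional invariant under `ψ ↦ 1_{S′}·ψ`
has r14's property `Local250 S S′` ((2.42)/(2.50)). [cite: Balaban1982Higgs2, (2.42) p.566] -/
theorem local250_of_invariant {X P α β : Type*} (S : Set X) (S' : Set P) {f : (X → ℝ) → α} {g : (P → ℝ) → β}
    (H : α → β → ℝ) (hf : ∀ B, f (S.indicator B) = f B) (hg : ∀ ψ, g (S'.indicator ψ) = g ψ) :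
    Local250 S S' (fun B ψ => H (f B) (g ψ)) := by
  intro B ψ
  simp only [hf, hg]

variable [Fintype X] [Fintype Y]

/-- **(2.42) for the quadratic main terms** of (2.37) (field `B`) and of (2.40) (field `ψ`): for ANY operators `M`
(↤ `Δ^{(1),L}_{Λ₅}`, resp. `Δ^{(1),L}_{Λ₅}(Λ₇ᶜ, B^{(1)})`) and `K` (↤ `QC^{(0)}_{Λ₅}Q*`, resp. `QC^{(0)}_{Λ₅}(Λ₇ᶜ,B^{(1)})Q*`), the
functional `B ↦ ½w⟨Λ′₆ᶜB, MΛ′₆ᶜB⟩ − c²w⟨(S∖Λ′₆)B, K(Λ′₆∖Λ′₇)B⟩` (`S = Λ′₅` in (2.37); `S = univ`, i.e. `Λ′₆ᶜψ` itself, in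
(2.40)) is unchanged under `B ↦ Λ′₇ᶜB` (`Λ′₇ ⊆ Λ′₆`). [cite: Balaban1982Higgs2, (2.42) p.566] -/
theorem form_terms_out7 {S Λ₆' Λ₇' : Finset Y} (h7 : Λ₇' ⊆ Λ₆') (c w : ℝ) (M K : Matrix Y Y ℝ) (B : Y → ℝ) :
    1 / 2 * (w * (((B - restrict Λ₇' B) - restrict Λ₆' (B - restrict Λ₇' B))
        ⬝ᵥ (M *ᵥ ((B - restrict Λ₇' B) - restrict Λ₆' (B - restrict Λ₇' B)))))
      - c ^ 2 * (w * (restrict (S \ Λ₆') (B - restrict Λ₇' B) ⬝ᵥ (K *ᵥ restrict (Λ₆' \ Λ₇') (B - restrict Λ₇' B))))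
    = 1 / 2 * (w * ((B - restrict Λ₆' B) ⬝ᵥ (M *ᵥ (B - restrict Λ₆' B))))
      - c ^ 2 * (w * (restrict (S \ Λ₆') B ⬝ᵥ (K *ᵥ restrict (Λ₆' \ Λ₇') B))) := by
  rw [out_sub_restrict_out h7, restrict_sdiff_out h7, restrict_sdiff_out']

/-- The same with `Λ′₆ᶜψ` unrestricted on the left of the second term (the (2.40) display).
[cite: Balaban1982Higgs2, (2.42) p.566] -/
theorem form_terms_out7' {Λ₆' Λ₇' : Finset Y} (h7 : Λ₇' ⊆ Λ₆') (c w : ℝ) (M : Matrix Y Y ℝ) (K : Matrix Y Y ℝ)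
    (ψ : Y → ℝ) :
    1 / 2 * (w * (((ψ - restrict Λ₇' ψ) - restrict Λ₆' (ψ - restrict Λ₇' ψ))
        ⬝ᵥ (M *ᵥ ((ψ - restrict Λ₇' ψ) - restrict Λ₆' (ψ - restrict Λ₇' ψ)))))
      - c ^ 2 * (w * (((ψ - restrict Λ₇' ψ) - restrict Λ₆' (ψ - restrict Λ₇' ψ))
        ⬝ᵥ (K *ᵥ restrict (Λ₆' \ Λ₇') (ψ - restrict Λ₇' ψ))))
    = 1 / 2 * (w * ((ψ - restrict Λ₆' ψ) ⬝ᵥ (M *ᵥ (ψ - restrict Λ₆' ψ))))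
      - c ^ 2 * (w * ((ψ - restrict Λ₆' ψ) ⬝ᵥ (K *ᵥ restrict (Λ₆' \ Λ₇') ψ))) := by
  rw [out_sub_restrict_out h7, restrict_sdiff_out']

/-- **(2.42), typed, for the main terms of (2.37)** (as a `B`-density; any `ψ`-mask `S′`): `Local250 (Λ′₇)ᶜ S′`.
[cite: Balaban1982Higgs2, (2.42) p.566] -/
theorem local242_form_terms {P : Type*} {S Λ₆' Λ₇' : Finset Y} (h7 : Λ₇' ⊆ Λ₆') (c w : ℝ) (M K : Matrix Y Y ℝ)
    (S' : Set P) :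
    Local250 ((↑Λ₇' : Set Y)ᶜ) S' (fun B _ =>
      1 / 2 * (w * ((B - restrict Λ₆' B) ⬝ᵥ (M *ᵥ (B - restrict Λ₆' B))))
        - c ^ 2 * (w * (restrict (S \ Λ₆') B ⬝ᵥ (K *ᵥ restrict (Λ₆' \ Λ₇') B)))) := by
  intro B _
  simp only [indicator_compl_eq]
  exact (form_terms_out7 h7 c w M K B).symm

/-- **(2.42), typed, for the main terms of (2.40)** (as a `ψ`-density; any `B`-mask `S`): `Local250 S (Λ′₇)ᶜ`.
[cite: Balaban1982Higgs2, (2.42) p.566] -/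
theorem local242_form_terms' {X' : Type*} {Λ₆' Λ₇' : Finset Y} (h7 : Λ₇' ⊆ Λ₆') (c w : ℝ) (M K : Matrix Y Y ℝ)
    (S : Set X') :
    Local250 S ((↑Λ₇' : Set Y)ᶜ) (fun _ ψ =>
      1 / 2 * (w * ((ψ - restrict Λ₆' ψ) ⬝ᵥ (M *ᵥ (ψ - restrict Λ₆' ψ))))
        - c ^ 2 * (w * ((ψ - restrict Λ₆' ψ) ⬝ᵥ (K *ᵥ restrict (Λ₆' \ Λ₇') ψ)))) := by
  intro _ ψ
  simp only [indicator_compl_eq]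
  exact (form_terms_out7' h7 c w M K ψ).symm

variable [DecidableEq X]

/-- **(2.42), typed, for the right side of (2.36)** `aL⁻²Σ_{st(Λ₅)}A(b₊)(C^{(0)}_{Λ₅}Q*Λ′₆ᶜB)(b₋)` (as a `B`-density, the
fine field `A` outside `Λ₅` a parameter): `Local250 (Λ′₇)ᶜ S′`. [cite: Balaban1982Higgs2, (2.42) p.566] -/
theorem local242_bdry_vector {P : Type*} {Λ₆' Λ₇' : Finset Y} (h7 : Λ₇' ⊆ Λ₆') (c : ℝ) (Λ : Finset X)
    (D CΛ : Matrix X X ℝ) (Qs : Matrix X Y ℝ) (A : X → ℝ) (S' : Set P) :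
    Local250 ((↑Λ₇' : Set Y)ᶜ) S' (fun B _ => bdry226 c Λ D CΛ Qs A (B - restrict Λ₆' B)) := by
  intro B _
  simp only [indicator_compl_eq, out_sub_restrict_out h7]

/-- **(2.42), typed, for the right side of (2.39)** `aL⁻²Σ_{st(Λ₅)}φ(b₊)U(C^{(0)}_{Λ₅}(Λ₆ᶜ,B^{(1)})Q*ψ)(b₋)` (as a `ψ`-density,
`φ` outside `Λ₅` a parameter), under the decoupling of `C^{(0)}_{Λ₅}(Λ₆ᶜ, B^{(1)})`: `Local250 S (Λ′₇)ᶜ`.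
[cite: Balaban1982Higgs2, (2.42) p.566] -/
theorem local242_bdry_scalar {X' : Type*} {Λ Λ6f : Finset X} {Λ₆' Λ₇' : Finset Y} {D C6 : Matrix X X ℝ}
    {Qs : Matrix X Y ℝ} (h7 : Λ₇' ⊆ Λ₆') (hQ6 : ∀ x'' y, Qs x'' y ≠ 0 → (x'' ∈ Λ6f ↔ y ∈ Λ₆'))
    (hC6dec : ∀ x' x'', C6 x' x'' ≠ 0 → x'' ∈ Λ6f → x' ∈ Λ6f)
    (hbdry6 : ∀ x ∉ Λ, ∀ x' ∈ Λ, D x x' ≠ 0 → x' ∉ Λ6f) (c : ℝ) (φ : X → ℝ) (S : Set X') :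
    Local250 S ((↑Λ₇' : Set Y)ᶜ) (fun _ ψ => bdry226 c Λ D C6 Qs φ ψ) := by
  intro _ ψ
  simp only [indicator_compl_eq, bdry226_out7 h7 hQ6 hC6dec hbdry6]

end Typed

end Literature.MathematicalPhysics.QuantumFieldTheory.Balaban1983to89.B2Eq242Locality
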